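import Summits.AtomisticToContinuum.Crystallization.Theorems.ChartedZeroExcessLayeredLatticeLiouvilleUN

/-!
# Zero-excess layered lattice Liouville — part UO (lens-2 g55, node «GluePiecesProved»): two of the three PROVABLE·S antecedents of the glue
# `CaccioppoliGlueBPG` (part UN) PROVED — (I5) `CaccioppoliIterationP` (Giaquinta's iteration lemma, closed form, no limit process) and
# (I0) `EquilChartIsometryP` (the equilibrium-chart class `IsEquilChart` and its model sets `LayeredHom` are invariant under rigid motions `q ↦ U q + v`);
# (I1) `PairForceTaylorP` and the discharged glue follow in part UP.

Continuation of part UN (critic row 869, option (1): «PROOFS of (I5), then (I1), then (I0); no GSC; imports UN»).  FINDINGS.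
(u1) (I5) — for `0 ≤ θ < 1`, `k ≥ 1` the constant is EXPLICIT: with the shrink ratio `λ := 1 − (1 − θ)/(2k)` (`1/2 ≤ λ < 1`) Bernoulli gives
  `μ := λ^k ≥ (1 + θ)/2 > θ`, and `c(θ, k) := μ/((μ − θ)(1 − λ)^k) + 1/(1 − θ)` works: the EXCESS `e t := f t − c·(A/(r₁ − t)^k + B)` satisfies the
  one-step inequality `e t ≤ θ·e (t + (1 − λ)(r₁ − t))` on `[r₀, r₁)` (absorption identities `1/(1 − λ)^k ≤ c − θc/μ`, `1 ≤ c − θc`), hence its supremum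
  `s` over `[r₀, r₁)` (finite: `f` is bounded above there and the subtracted term is `≥ 0`) obeys `s ≤ θ·max(s, 0)`, so `s ≤ 0` — the textbook's geometric
  sequence of radii and its limit are replaced by ONE `sSup` (Giaquinta 1983, Ch. V Lemma 3.1, p. 161; Giaquinta–Martinazzi 2012, Lemma 8.18).
(u2) (I0) — `L' := L.trans U` (as a continuous linear equivalence), `w' m := U (w m) + v`: `LayeredHom L' (U ∘ w) = U '' LayeredHom L w`
  (`layeredHom_trans_isometry`), the operator bounds `‖L'‖, ‖L'⁻¹‖ ≤ Λ` and the `s`-conformality (`Q' := Q.trans U`) are checked POINTWISE (`‖U x‖ = ‖x‖`),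
  two-shell goodness / cleanliness at every ceiling (`isTwoShellGoodSet_isometry`, `isCleanP_μS_isometry`: rotate the pattern isometry `A ↦ U ∘ A` and the
  matching `f ↦ U ∘ f`) and single-site Nash cage-minimality (`isNash_μS_isometry`: re-index the cage sums by `U`, distances preserved) are ISOMETRY
  INVARIANT — the isometry half of the rigid-motion invariance whose translation half is part TJ §XII.2 (`IsEquilChart.translate`, `layeredHom_add_const`);
  composing the two halves is (I0) (`equilChartIsometryP_holds`).
CONTENTS §UO.1 (I5) PROVED; §UO.2 isometry invariance of the chart currency, (I0) PROVED.  RESIDUALS of the line after this part: as after part UN with (I0), (I5)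
discharged ((I1) is discharged in part UP): [T_bᵇ]; [W_Ψᵇ]; the glue `CaccioppoliGlueBPG` (ATTACKABLE·M–L), (I4) `TailFluxBP` (M), [SBᵇ] `SubWindowBudgetBPG`
(UNDECIDED · INSTRUMENTABLE).  No `sorry`, no new axiom, no instance / notation / option; no new `def`.  Literature: Giaquinta, *Multiple integrals in the
calculus of variations and nonlinear elliptic systems* (1983) Ch. V Lemma 3.1; Giaquinta–Martinazzi, *An introduction to the regularity theory* (2012) Lemma 8.18;
parts O, Q (the chart currency), TH, TJ (translation invariance), UN.
-/

noncomputable section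

open scoped BigOperators InnerProductSpace RealInnerProductSpace
open MeasureTheory Set Metric Filter Topology
open Summit.AtomisticToContinuum.Crystallization.Theorems.ChartedPlanarOrderRigidityDoor (E3 IsClean IsNash atomsIn)
open Summit.AtomisticToContinuum.Crystallization.Theorems.ChartedPlanarOrderDensityDichotomy (μS IsSep nK nK_nonneg)
open Summit.AtomisticToContinuum.Crystallization.Theorems.ChartedPlanarOrderCleanScaleP (IsCleanP IsDoorSetP isCleanP_one_iff isCleanP_μS_iff)
open Summit.AtomisticToContinuum.Crystallization.Theorems.ChartedPlanarOrderMesoCut (LayeredHom EnvClose)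
open Summit.AtomisticToContinuum.Crystallization.Theorems.ChartedPlanarOrderDoorLayered (atomsIn_subset)
open Summit.AtomisticToContinuum.Crystallization.Theorems.ChartedPlanarOrderDoorLayeredOsc (IsTwoShellAffineGood)
open Summit.AtomisticToContinuum.Crystallization.Theorems.ChartedPlanarOrderProfileSlavingLJ (pairForce)
open Literature.MathematicalPhysics.StatisticalMechanics (lennardJones triangularVec₁ triangularVec₂)
open Literature.Geometry.DiscreteGeometry (IsTwoShellGoodSet)
open Literature.Analysis.PDE (finavg ZatorskaGoldstein2005_localGehringLemmaCounting)

namespace Summit.AtomisticToContinuum.Crystallization.Theorems.ChartedZeroExcessLayeredLatticeLiouville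

/-! ### UO.1  (I5) The iteration lemma (PROVED) -/

/-- ★★ **(I5) PROVED — `CaccioppoliIterationP`** [Giaquinta 1983, Ch. V Lemma 3.1]: closed-form constant `c(θ,k) = μ/((μ − θ)(1 − λ)^k) + 1/(1 − θ)`,
`λ = 1 − (1 − θ)/(2k)`, `μ = λ^k`; proof by the supremum of the excess `f t − c(A/(r₁ − t)^k + B)` over `[r₀, r₁)` ((u1) of the header). [this file, g55] -/
theorem caccioppoliIterationP_holds : CaccioppoliIterationP := by
  intro θ hθ0 hθ1 k hk
  have hk1 : (1 : ℝ) ≤ k := by exact_mod_cast hk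
  -- the shrink ratio `lam = 1 − (1−θ)/(2k)`: `1/2 ≤ lam < 1` and `lam ^ k ≥ (1+θ)/2 > θ` (Bernoulli)
  set lam : ℝ := 1 - (1 - θ) / (2 * k) with hlam_def
  have hfrac_pos : 0 < (1 - θ) / (2 * k) := div_pos (by linarith) (by positivity)
  have hfrac_le : (1 - θ) / (2 * k) ≤ 1 / 2 := by
    rw [div_le_iff₀ (by positivity)]
    nlinarith
  have hlam1 : lam < 1 := by rw [hlam_def]; linarith
  have hlam0 : 0 < lam := by rw [hlam_def]; linarith
  have h1lam : 0 < 1 - lam := by linarith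
  have hμ : (1 + θ) / 2 ≤ lam ^ k := by
    have h := one_add_mul_le_pow (a := -((1 - θ) / (2 * k))) (by linarith) k
    have e1 : (1 : ℝ) + k * -((1 - θ) / (2 * k)) = (1 + θ) / 2 := by
      field_simp
      ring
    have e2 : (1 : ℝ) + -((1 - θ) / (2 * k)) = lam := by rw [hlam_def]; ring
    rw [e1, e2] at h
    exact h
  set μ : ℝ := lam ^ k with hμ_def
  have hμθ : θ < μ := by linarith
  have hμpos : 0 < μ := by positivity
  -- the constant
  set c : ℝ := μ / ((μ - θ) * (1 - lam) ^ k) + 1 / (1 - θ) with hc_def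
  have hc1 : 0 < μ / ((μ - θ) * (1 - lam) ^ k) := div_pos hμpos (mul_pos (by linarith) (pow_pos h1lam k))
  have hc2 : 0 < 1 / (1 - θ) := div_pos one_pos (by linarith)
  have hc : 0 < c := by linarith
  refine ⟨c, hc, ?_⟩
  intro f A B r₀ r₁ hA hB hr _hf0 hbdd hiter
  -- the two absorption inequalities the constant is built for
  have hcA : 1 / (1 - lam) ^ k ≤ c - θ * c / μ := by
    have e : c - θ * c / μ = c * ((μ - θ) / μ) := by
      field_simp
    rw [e]
    have hne1 : (μ - θ) ≠ 0 := by linarith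
    have hne2 : (1 - lam) ^ k ≠ 0 := pow_ne_zero k h1lam.ne'
    have e' : μ / ((μ - θ) * (1 - lam) ^ k) * ((μ - θ) / μ) = 1 / (1 - lam) ^ k := by
      field_simp
    calc 1 / (1 - lam) ^ k = μ / ((μ - θ) * (1 - lam) ^ k) * ((μ - θ) / μ) := e'.symm
      _ ≤ c * ((μ - θ) / μ) :=
          mul_le_mul_of_nonneg_right (by linarith) (div_nonneg (by linarith) hμpos.le)
  have hcB : 1 ≤ c - θ * c := by
    have e : c - θ * c = c * (1 - θ) := by ring
    rw [e]
    have hne : (1 - θ) ≠ 0 := by linarith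
    have e' : 1 / (1 - θ) * (1 - θ) = 1 := by
      rw [one_div, inv_mul_cancel₀ hne]
    calc (1 : ℝ) = 1 / (1 - θ) * (1 - θ) := e'.symm
      _ ≤ c * (1 - θ) := mul_le_mul_of_nonneg_right (by linarith) (by linarith)
  -- the excess `e t := f t − c·(A/(r₁ − t)^k + B)` contracts along `t ↦ t + (1 − lam)(r₁ − t)`
  set e : ℝ → ℝ := fun t => f t - c * (A / (r₁ - t) ^ k + B) with he_def
  have hstep : ∀ t, r₀ ≤ t → t < r₁ → e t ≤ θ * e (t + (1 - lam) * (r₁ - t)) := by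
    intro t ht0 ht1
    have hD : 0 < r₁ - t := by linarith
    have hDk : 0 < (r₁ - t) ^ k := pow_pos hD k
    have htτ : t < t + (1 - lam) * (r₁ - t) := by nlinarith [mul_pos h1lam hD]
    have hτ1 : t + (1 - lam) * (r₁ - t) ≤ r₁ := by nlinarith [mul_pos hlam0 hD]
    have h := hiter t (t + (1 - lam) * (r₁ - t)) ht0 htτ hτ1
    have eτt : t + (1 - lam) * (r₁ - t) - t = (1 - lam) * (r₁ - t) := by ring
    have eτr : r₁ - (t + (1 - lam) * (r₁ - t)) = lam * (r₁ - t) := by ring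
    rw [eτt, mul_pow] at h
    show f t - c * (A / (r₁ - t) ^ k + B) ≤
      θ * (f (t + (1 - lam) * (r₁ - t)) - c * (A / (r₁ - (t + (1 - lam) * (r₁ - t))) ^ k + B))
    rw [eτr, mul_pow, ← hμ_def]
    set X : ℝ := A / (r₁ - t) ^ k with hX_def
    have hX : 0 ≤ X := div_nonneg hA hDk.le
    have e3 : A / ((1 - lam) ^ k * (r₁ - t) ^ k) = 1 / (1 - lam) ^ k * X := by
      rw [hX_def]
      field_simp
    have e4 : A / (μ * (r₁ - t) ^ k) = 1 / μ * X := by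
      rw [hX_def]
      field_simp
    rw [e3] at h
    rw [e4]
    have h5 : 1 / (1 - lam) ^ k * X ≤ (c - θ * c / μ) * X := mul_le_mul_of_nonneg_right hcA hX
    have h6 : B ≤ (c - θ * c) * B := by nlinarith
    have e7 : θ * (f (t + (1 - lam) * (r₁ - t)) - c * (1 / μ * X + B)) =
        θ * f (t + (1 - lam) * (r₁ - t)) + (c - θ * c / μ) * X + (c - θ * c) * B - c * (X + B) := by ring
    rw [e7]
    linarith
  -- the supremum of the excess over `[r₀, r₁)` is `≤ θ · max(sup, 0)`, hence `≤ 0`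
  have hbddE : BddAbove (e '' Ico r₀ r₁) := by
    obtain ⟨M, hM⟩ := hbdd
    refine ⟨M, ?_⟩
    rintro _ ⟨t, ht, rfl⟩
    have hft : f t ≤ M := hM ⟨t, Ico_subset_Icc_self ht, rfl⟩
    have h0 : 0 ≤ c * (A / (r₁ - t) ^ k + B) :=
      mul_nonneg hc.le (add_nonneg (div_nonneg hA (pow_nonneg (by linarith [ht.2]) k)) hB)
    show f t - c * (A / (r₁ - t) ^ k + B) ≤ M
    linarith
  have hne : (e '' Ico r₀ r₁).Nonempty := ⟨e r₀, r₀, ⟨le_rfl, hr⟩, rfl⟩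
  have hs_le : sSup (e '' Ico r₀ r₁) ≤ θ * max (sSup (e '' Ico r₀ r₁)) 0 := by
    refine csSup_le hne ?_
    rintro _ ⟨t, ht, rfl⟩
    have hD : 0 < r₁ - t := by linarith [ht.2]
    have hτmem : t + (1 - lam) * (r₁ - t) ∈ Ico r₀ r₁ :=
      ⟨by nlinarith [mul_pos h1lam hD, ht.1], by nlinarith [mul_pos hlam0 hD]⟩
    have h2 : e (t + (1 - lam) * (r₁ - t)) ≤ max (sSup (e '' Ico r₀ r₁)) 0 :=
      (le_csSup hbddE ⟨_, hτmem, rfl⟩).trans (le_max_left _ _)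
    exact (hstep t ht.1 ht.2).trans (mul_le_mul_of_nonneg_left h2 hθ0)
  have hs0 : sSup (e '' Ico r₀ r₁) ≤ 0 := by
    by_contra hpos
    rw [not_le] at hpos
    rw [max_eq_left hpos.le] at hs_le
    nlinarith [mul_pos (sub_pos.2 hθ1) hpos]
  have her₀ : e r₀ ≤ sSup (e '' Ico r₀ r₁) := le_csSup hbddE ⟨r₀, ⟨le_rfl, hr⟩, rfl⟩
  have hfin : f r₀ - c * (A / (r₁ - r₀) ^ k + B) ≤ 0 := her₀.trans hs0
  linarith

/-! ### UO.2  Rigid-motion invariance of the chart currency — the isometry half ((I0) PROVED; the translation half is part TJ §XII.2) -/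

/-- composing the chart with a linear isometry maps the model set by the isometry. [folklore; this file, g55] -/
theorem layeredHom_trans_isometry (L : E3 ≃L[ℝ] E3) (w : ℤ → E3) (U : E3 ≃ₗᵢ[ℝ] E3) :
    LayeredHom ((L.trans U.toContinuousLinearEquiv : E3 ≃L[ℝ] E3) : E3 →L[ℝ] E3) (fun m => U (w m)) =
      U '' LayeredHom (L : E3 →L[ℝ] E3) w := by
  ext p
  constructor
  · rintro ⟨m, i, j, hp⟩
    refine ⟨L (((i : ℝ) • triangularVec₁ 1) + ((j : ℝ) • triangularVec₂ 1)) + w m, ⟨m, i, j, rfl⟩, ?_⟩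
    rw [hp]
    simp only [ContinuousLinearEquiv.coe_coe, ContinuousLinearEquiv.trans_apply, LinearIsometryEquiv.coe_toContinuousLinearEquiv,
      map_add]
  · rintro ⟨q, ⟨m, i, j, hq⟩, rfl⟩
    refine ⟨m, i, j, ?_⟩
    rw [hq]
    simp only [ContinuousLinearEquiv.coe_coe, ContinuousLinearEquiv.trans_apply, LinearIsometryEquiv.coe_toContinuousLinearEquiv,
      map_add]

/-- two-shell goodness of a site in a set is invariant under a linear isometry of the ambient space. [folklore; this file, g55] -/
theorem isTwoShellGoodSet_isometry {ε lo hi : ℝ} {Y : Set E3} {q : E3} (U : E3 ≃ₗᵢ[ℝ] E3) (h : IsTwoShellGoodSet ε lo hi Y q) :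
    IsTwoShellGoodSet ε lo hi (U '' Y) (U q) := by
  obtain ⟨a, ha₁, ha₂, A, P, f, hP, hf, hinj, hcov⟩ := h
  refine ⟨a, ha₁, ha₂, U.toLinearIsometry.comp A, P, fun w => U (f w), hP, fun w hw => ⟨⟨f w, (hf w hw).1, rfl⟩, ?_⟩,
    fun w hw w' hw' he => hinj hw hw' (U.injective he), ?_⟩
  · have e : U q + a • (U.toLinearIsometry.comp A) w = U (q + a • A w) := by
      simp only [LinearIsometry.coe_comp, Function.comp_apply, LinearIsometryEquiv.coe_toLinearIsometry, map_add, map_smul]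
    rw [e, LinearIsometryEquiv.dist_map]
    exact (hf w hw).2
  · rintro y ⟨y₀, hy₀, rfl⟩ hne hd
    have hne₀ : y₀ ≠ q := fun e => hne (by rw [e])
    rw [LinearIsometryEquiv.dist_map] at hd
    obtain ⟨w, hw, hfw⟩ := hcov y₀ hy₀ hne₀ hd
    exact ⟨w, hw, by simp only [hfw]⟩

/-- cleanliness at any ceiling is invariant under a linear isometry. [folklore; this file, g55] -/
theorem isCleanP_μS_isometry {aHi : ℝ} {Y : Set E3} (U : E3 ≃ₗᵢ[ℝ] E3) (h : IsCleanP aHi (μS Y)) :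
    IsCleanP aHi (μS (U '' Y)) :=
  (isCleanP_μS_iff _).2 (by
    rintro q ⟨q₀, hq₀, rfl⟩
    exact isTwoShellGoodSet_isometry U ((isCleanP_μS_iff Y).1 h q₀ hq₀))

/-- the Nash (single-site cage-minimality) clause is invariant under a linear isometry: cage sums are re-indexed by the isometry and distances are
preserved. [folklore; this file, g55] -/
theorem isNash_μS_isometry {Y : Set E3} (U : E3 ≃ₗᵢ[ℝ] E3) (h : IsNash (μS Y)) : IsNash (μS (U '' Y)) := by
  have hm₀ : ∀ q : E3, μS Y {q} ≠ 0 ↔ q ∈ Y := fun q =>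
    Literature.Probability.Process.count_restrict_singleton_ne_zero_iff Y q
  have hm : ∀ q : E3, μS (U '' Y) {q} ≠ 0 ↔ U.symm q ∈ Y := fun q => by
    rw [Literature.Probability.Process.count_restrict_singleton_ne_zero_iff]
    constructor
    · rintro ⟨q₀, hq₀, rfl⟩
      simpa only [LinearIsometryEquiv.symm_apply_apply] using hq₀
    · intro hq
      exact ⟨U.symm q, hq, U.apply_symm_apply q⟩
  intro p hp y hy
  have hp₀ : μS Y {U.symm p} ≠ 0 := (hm₀ _).2 ((hm p).1 hp)
  have hy₀ : ∀ q : E3, μS Y {q} ≠ 0 → q ≠ U.symm p → U.symm y ≠ q := by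
    intro q hq hne he
    refine hy (U q) ((hm _).2 (by simpa only [LinearIsometryEquiv.symm_apply_apply] using (hm₀ q).1 hq)) (fun e => hne ?_) ?_
    · rw [← e, LinearIsometryEquiv.symm_apply_apply]
    · rw [← he, LinearIsometryEquiv.apply_symm_apply]
  have key := h (U.symm p) hp₀ (U.symm y) hy₀
  let e : {q : E3 // μS Y {q} ≠ 0 ∧ q ≠ U.symm p} ≃ {q : E3 // μS (U '' Y) {q} ≠ 0 ∧ q ≠ p} :=
    { toFun := fun q => ⟨U q.1, (hm _).2 (by simpa only [LinearIsometryEquiv.symm_apply_apply] using (hm₀ _).1 q.2.1),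
        fun e => q.2.2 ((U.symm_apply_apply q.1).symm.trans (congrArg U.symm e))⟩
      invFun := fun q => ⟨U.symm q.1, (hm₀ _).2 ((hm _).1 q.2.1), fun e => q.2.2 (U.symm.injective e)⟩
      left_inv := fun q => Subtype.ext (U.symm_apply_apply q.1)
      right_inv := fun q => Subtype.ext (U.apply_symm_apply q.1) }
  have hd : ∀ (z : E3) (q : E3), dist z (U q) = dist (U.symm z) q := fun z q => by
    conv_lhs => rw [← U.apply_symm_apply z]
    exact U.dist_map _ _
  have h1 : ∑' q : {q : E3 // μS (U '' Y) {q} ≠ 0 ∧ q ≠ p}, lennardJones (dist p (q : E3)) =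
      ∑' q : {q : E3 // μS Y {q} ≠ 0 ∧ q ≠ U.symm p}, lennardJones (dist (U.symm p) (q : E3)) := by
    rw [← e.tsum_eq]
    exact tsum_congr fun q => by rw [show ((e q : _) : E3) = U q.1 from rfl, hd]
  have h2 : ∑' q : {q : E3 // μS (U '' Y) {q} ≠ 0 ∧ q ≠ p}, lennardJones (dist y (q : E3)) =
      ∑' q : {q : E3 // μS Y {q} ≠ 0 ∧ q ≠ U.symm p}, lennardJones (dist (U.symm y) (q : E3)) := by
    rw [← e.tsum_eq]
    exact tsum_congr fun q => by rw [show ((e q : _) : E3) = U q.1 from rfl, hd]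
  rw [h1, h2]
  exact key

/-- ★ **equilibrium charts are isometry invariant** (compose the chart with `U`, rotate the stacking data). [this file, g55] -/
theorem IsEquilChart.isometry {a s Λ : ℝ} {L : E3 ≃L[ℝ] E3} {w : ℤ → E3} (h : IsEquilChart a s Λ L w) (U : E3 ≃ₗᵢ[ℝ] E3) :
    IsEquilChart a s Λ (L.trans U.toContinuousLinearEquiv) (fun m => U (w m)) := by
  have hΛ : 0 ≤ Λ := (norm_nonneg _).trans h.1
  refine ⟨?_, ?_, ?_, ?_, ?_⟩
  · refine ContinuousLinearMap.opNorm_le_bound _ hΛ fun x => ?_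
    simpa only [ContinuousLinearEquiv.coe_coe, ContinuousLinearEquiv.trans_apply, LinearIsometryEquiv.coe_toContinuousLinearEquiv,
      LinearIsometryEquiv.norm_map] using (L : E3 →L[ℝ] E3).le_of_opNorm_le h.1 x
  · refine ContinuousLinearMap.opNorm_le_bound _ hΛ fun x => ?_
    simpa only [ContinuousLinearEquiv.coe_coe, ContinuousLinearEquiv.symm_trans_apply, LinearIsometryEquiv.coe_symm_toContinuousLinearEquiv,
      LinearIsometryEquiv.norm_map] using (L.symm : E3 →L[ℝ] E3).le_of_opNorm_le h.2.1 (U.symm x)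
  · obtain ⟨Q, hQ⟩ := h.2.2.1
    refine ⟨Q.trans U, ContinuousLinearMap.opNorm_le_bound _ ((norm_nonneg _).trans hQ) fun x => ?_⟩
    have h1 := ((L : E3 →L[ℝ] E3) - a • (Q.toContinuousLinearEquiv : E3 →L[ℝ] E3)).le_of_opNorm_le hQ x
    simp only [sub_apply, smul_apply, ContinuousLinearEquiv.coe_coe, LinearIsometryEquiv.coe_toContinuousLinearEquiv] at h1
    have e : U (L x) - a • U (Q x) = U (L x - a • Q x) := by rw [map_sub, map_smul]
    simp only [sub_apply, smul_apply, ContinuousLinearEquiv.coe_coe, ContinuousLinearEquiv.trans_apply,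
      LinearIsometryEquiv.coe_toContinuousLinearEquiv, LinearIsometryEquiv.trans_apply]
    rw [e, LinearIsometryEquiv.norm_map]
    exact h1
  · rw [layeredHom_trans_isometry]
    exact (isCleanP_one_iff _).1 (isCleanP_μS_isometry U ((isCleanP_one_iff _).2 h.2.2.2.1))
  · rw [layeredHom_trans_isometry]
    exact isNash_μS_isometry U h.2.2.2.2

/-- ★★ **(I0) PROVED**: the equilibrium-chart class is invariant under rigid motions `q ↦ U q + v`. -/
theorem equilChartIsometryP_holds : EquilChartIsometryP := by
  intro a s Λ L w U v h
  refine ⟨L.trans U.toContinuousLinearEquiv, fun m => U (w m) + v, (h.isometry U).translate v, ?_⟩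
  rw [layeredHom_add_const, layeredHom_trans_isometry, Set.image_image]

end Summit.AtomisticToContinuum.Crystallization.Theorems.ChartedZeroExcessLayeredLatticeLiouville

end
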